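import Literature.NumberTheory.Sieve.FordMaynardPolyLip
import Mathlib.MeasureTheory.Integral.Bochner.Set
import Mathlib.MeasureTheory.Measure.Lebesgue.EqHaar
import Mathlib.MeasureTheory.Function.LocallyIntegrable
import Mathlib.LinearAlgebra.FiniteDimensional.Lemmas
import HarnessLib

/-!
# Fibre integrals of piecewise-Lipschitz functions on polytopes are piecewise Lipschitz

The analytic mechanism behind "functions defined by the fragmentation relation (fsl) from
piecewise-Lipschitz data are again piecewise Lipschitz" (K. Ford, J. Maynard, arXiv:2407.14368,
used in §6.2 and §9 without comment). Everything here is PROVED.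

* `exists_volume_slab_le` — **slab estimate**: for a non-zero linear functional `ψ` on `ℝ^I` and a
  coordinate box `B`, `vol(B ∩ {lo ≤ ψ ≤ hi}) ≤ C (hi − lo)` (shear `U_l ↦ ψ(U)` and the
  determinant formula for Lebesgue measure).
* `exists_piece_integral` — for ONE piece `𝟙_Q L` (`Q ⊆ D × B` polyhedral, `L` Lipschitz, bounded
  on `Q`): `ξ ↦ ∫ 𝟙_Q L (ξ, U) dU` vanishes outside a bounded polyhedral set `P ⊆ D` (cut out by the
  constraints of `Q` not involving `U`) and is Lipschitz on `P`: moving `ξ` moves the integrand by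
  `≤ K |ξ − ξ'|` on `Q_ξ ∩ Q_ξ'` and changes the fibre `Q_ξ` by slabs of width `≤ ‖φ‖ |ξ − ξ'|`.
* `PolyLip.isPiecewiseLipschitz'_integral` — for `F ∈ PolyLip(E₁ × ℝ^I)` vanishing outside `D × B`,
  `ξ ↦ ∫ F(ξ, U) dU` is piecewise Lipschitz (`IsPiecewiseLipschitz'`).

## References

* K. Ford, J. Maynard, *On the theory of prime producing sieves*, arXiv:2407.14368v1 (2024), §6.2
  (proof of Theorem 6.3: "By Theorem 6.4, (TypeI-f) holds for `h`; that is, `h ∈ 𝔉_η`") and §9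
  (proof of Theorem 9.1: "Then `f̃ ∈ 𝔉_η(P)` since `𝒟_{k,η}(P)` is a finite union of convex
  polytopes"). [FordMaynard2024PrimeSieves]
-/

noncomputable section

open Set MeasureTheory

namespace Literature.NumberTheory.Sieve.FordMaynard

/-! ### Boxes in `ℝ^I` -/

section Box

variable {I : Type*} [Fintype I]

/-- The coordinate box `{U | ∀ i, |U i| ≤ R}` of `ℝ^I` is polyhedral. [folklore] -/
theorem isPolyhedral_absBox (R : ℝ) : IsPolyhedral {U : I → ℝ | ∀ i, |U i| ≤ R} := by
  classical
  obtain ⟨e⟩ := (Fintype.truncEquivFin I).nonempty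
  have h1 : IsPolyhedral {U : I → ℝ | ∀ i : Fin (Fintype.card I), U (e.symm i) ≤ R} :=
    IsPolyhedral.setOf_forall fun i => by
      simpa using isPolyhedral_le (LinearMap.proj (R := ℝ) (φ := fun _ : I => ℝ) (e.symm i)) R
  have h2 : IsPolyhedral {U : I → ℝ | ∀ i : Fin (Fintype.card I), -R ≤ U (e.symm i)} :=
    IsPolyhedral.setOf_forall fun i => by
      simpa using isPolyhedral_ge (LinearMap.proj (R := ℝ) (φ := fun _ : I => ℝ) (e.symm i)) (-R)
  convert h1.inter h2 using 1
  ext U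
  simp only [Set.mem_setOf_eq, Set.mem_inter_iff, abs_le]
  constructor
  · intro h
    exact ⟨fun i => (h _).2, fun i => (h _).1⟩
  · rintro ⟨ha, hb⟩ i
    have := ha (e i)
    have := hb (e i)
    simp only [Equiv.symm_apply_apply] at *
    exact ⟨‹_›, by assumption⟩

omit [Fintype I] in
/-- The coordinate box is the order interval `[-R, R]^I`. [folklore] -/
theorem absBox_eq_Icc (R : ℝ) :
    {U : I → ℝ | ∀ i, |U i| ≤ R} = Set.Icc (fun _ => -R) (fun _ => R) := by
  ext U
  simp only [Set.mem_setOf_eq, Set.mem_Icc, abs_le]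
  exact ⟨fun h => ⟨fun i => (h i).1, fun i => (h i).2⟩, fun h i => ⟨h.1 i, h.2 i⟩⟩

omit [Fintype I] in
/-- The coordinate box is compact. [folklore] -/
theorem isCompact_absBox (R : ℝ) : IsCompact {U : I → ℝ | ∀ i, |U i| ≤ R} := by
  rw [absBox_eq_Icc]
  exact isCompact_Icc

/-- The coordinate box is measurable. [folklore] -/
theorem measurableSet_absBox (R : ℝ) : MeasurableSet {U : I → ℝ | ∀ i, |U i| ≤ R} :=
  (isCompact_absBox R).isClosed.measurableSet

/-- The coordinate box has finite volume. [folklore] -/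
theorem volume_absBox_ne_top (R : ℝ) : volume {U : I → ℝ | ∀ i, |U i| ≤ R} ≠ ⊤ :=
  (isCompact_absBox R).measure_lt_top.ne

end Box

/-! ### The slab estimate -/

section Slab

variable {I : Type*} [Fintype I]

/-- **Slab estimate.** For a non-zero linear functional `ψ` on `ℝ^I` and `R`, there is `C ≥ 0` with
`vol({U : |Uᵢ| ≤ R ∀ i, lo ≤ ψ U ≤ hi}) ≤ C (hi − lo)` for all `lo ≤ hi`: shear the coordinate `U_l`
(with `ψ(e_l) ≠ 0`) to `ψ(U)`; the slab becomes a box with one side `[lo, hi]`, and Lebesgue measure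
changes by the factor `|det|⁻¹`. [folklore] -/
theorem exists_volume_slab_le (ψ : (I → ℝ) →ₗ[ℝ] ℝ) (hψ : ψ ≠ 0) (R : ℝ) :
    ∃ C : ℝ, 0 ≤ C ∧ ∀ lo hi : ℝ, lo ≤ hi →
      (volume {U : I → ℝ | (∀ i, |U i| ≤ R) ∧ lo ≤ ψ U ∧ ψ U ≤ hi}).toReal ≤ C * (hi - lo) := by
  classical
  set e : I → I → ℝ := fun i j => if i = j then 1 else 0 with he
  -- `ψ U = ∑ᵢ Uᵢ ψ(eᵢ)` is Mathlib's `LinearMap.pi_apply_eq_sum_univ` (`•` on `ℝ` is `*`)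
  have hsum : ∀ U, ψ U = ∑ i, U i * ψ (e i) := fun U => LinearMap.pi_apply_eq_sum_univ ψ U
  obtain ⟨l, hl⟩ : ∃ l, ψ (e l) ≠ 0 := by
    by_contra h
    push Not at h
    apply hψ
    refine LinearMap.ext fun U => ?_
    rw [hsum U]
    simp [h]
  set a := ψ (e l) with ha
  -- the shear `U ↦ (U with U_l replaced by ψ U)`
  let A : (I → ℝ) →ₗ[ℝ] (I → ℝ) := LinearMap.pi fun i => if i = l then ψ else LinearMap.proj i
  have hA : ∀ U i, A U i = if i = l then ψ U else U i := by
    intro U i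
    simp only [A, LinearMap.pi_apply]
    split_ifs <;> rfl
  have hinj : Function.Injective A := by
    intro U V hUV
    have h1 : ∀ i, i ≠ l → U i = V i := fun i hi => by
      have := congrFun hUV i
      rwa [hA, hA, if_neg hi, if_neg hi] at this
    have h2 : ψ U = ψ V := by
      have := congrFun hUV l
      rwa [hA, hA, if_pos rfl, if_pos rfl] at this
    have h3 : ψ (U - V) = (U l - V l) * a := by
      rw [hsum (U - V), Finset.sum_eq_single l]
      · simp [ha]
      · intro i _ hi
        simp [h1 i hi]
      · simp
    have h4 : U l = V l := by
      rw [map_sub, h2, sub_self] at h3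
      rcases mul_eq_zero.1 h3.symm with h | h
      · linarith
      · exact absurd h hl
    funext i
    by_cases hi : i = l
    · rw [hi]; exact h4
    · exact h1 i hi
  let Ae : (I → ℝ) ≃ₗ[ℝ] (I → ℝ) := LinearMap.linearEquivOfInjective A hinj rfl
  have hAe : ∀ U, Ae U = A U := fun U => rfl
  set R' := |R| with hR'
  set D : ℝ := |LinearMap.det (Ae.symm : (I → ℝ) →ₗ[ℝ] (I → ℝ))| with hD
  refine ⟨D * ∏ i ∈ Finset.univ.erase l, (2 * R'), by positivity, fun lo hi hlohi => ?_⟩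
  set lo' : I → ℝ := fun i => if i = l then lo else -R' with hlo'
  set hi' : I → ℝ := fun i => if i = l then hi else R' with hhi'
  have hle : lo' ≤ hi' := fun i => by
    simp only [hlo', hhi']
    split_ifs
    · exact hlohi
    · linarith [abs_nonneg R]
  have hsub : {U : I → ℝ | (∀ i, |U i| ≤ R) ∧ lo ≤ ψ U ∧ ψ U ≤ hi} ⊆ Ae ⁻¹' Set.Icc lo' hi' := by
    intro U hU
    obtain ⟨hUR, hU1, hU2⟩ := hU
    rw [Set.mem_preimage, Set.mem_Icc]
    refine ⟨fun i => ?_, fun i => ?_⟩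
    · rw [hAe, hA]
      simp only [hlo']
      split_ifs with hi
      · exact hU1
      · have := hUR i
        rw [abs_le] at this
        linarith [le_abs_self R, this.1]
    · rw [hAe, hA]
      simp only [hhi']
      split_ifs with hi
      · exact hU2
      · have := hUR i
        rw [abs_le] at this
        linarith [le_abs_self R, this.2]
  have hvol : volume (Ae ⁻¹' Set.Icc lo' hi') = ENNReal.ofReal D * volume (Set.Icc lo' hi') := by
    rw [MeasureTheory.Measure.addHaar_preimage_linearEquiv]
  have hIcc : (volume (Set.Icc lo' hi')).toReal = (hi - lo) * ∏ i ∈ Finset.univ.erase l, (2 * R') := by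
    rw [Real.volume_Icc_pi_toReal hle, ← Finset.mul_prod_erase _ _ (Finset.mem_univ l)]
    congr 1
    · simp [hlo', hhi']
    · refine Finset.prod_congr rfl fun i hi => ?_
      rw [Finset.mem_erase] at hi
      simp only [hlo', hhi', if_neg hi.1]
      ring
  have hfin : volume (Ae ⁻¹' Set.Icc lo' hi') ≠ ⊤ := by
    rw [hvol]
    exact ENNReal.mul_ne_top ENNReal.ofReal_ne_top (isCompact_Icc.measure_lt_top).ne
  calc (volume {U : I → ℝ | (∀ i, |U i| ≤ R) ∧ lo ≤ ψ U ∧ ψ U ≤ hi}).toReal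
      ≤ (volume (Ae ⁻¹' Set.Icc lo' hi')).toReal := ENNReal.toReal_mono hfin (measure_mono hsub)
    _ = D * ((hi - lo) * ∏ i ∈ Finset.univ.erase l, (2 * R')) := by
        rw [hvol, ENNReal.toReal_mul, ENNReal.toReal_ofReal (by positivity), hIcc]
    _ = (D * ∏ i ∈ Finset.univ.erase l, (2 * R')) * (hi - lo) := by ring

end Slab

/-! ### One piece: `ξ ↦ ∫ 𝟙_Q L (ξ, U) dU` -/

section Piece

variable {E₁ : Type*} [NormedAddCommGroup E₁] [NormedSpace ℝ E₁] [FiniteDimensional ℝ E₁]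
variable {I : Type*} [Fintype I]

/-- Translating a scalar constraint: `a + v ⊲ b ↔ v ⊲ b − a`. [folklore] -/
theorem halfRel_add_iff (s : Bool) (a v b : ℝ) : HalfRel s (a + v) b ↔ HalfRel s v (b - a) := by
  cases s
  · simp only [halfRel_false]; constructor <;> intro h <;> linarith
  · simp only [halfRel_true]; constructor <;> intro h <;> linarith

omit [FiniteDimensional ℝ E₁] [Fintype I] in
/-- A linear functional on a product splits: `φ (ξ, U) = φ(ξ, 0) + φ(0, U)`. [folklore] -/
theorem linearMap_prod_apply (φ : (E₁ × (I → ℝ)) →ₗ[ℝ] ℝ) (ξ : E₁) (U : I → ℝ) :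
    φ (ξ, U) = φ.comp (LinearMap.inl ℝ E₁ (I → ℝ)) ξ + φ.comp (LinearMap.inr ℝ E₁ (I → ℝ)) U := by
  rw [LinearMap.comp_apply, LinearMap.comp_apply, LinearMap.inl_apply, LinearMap.inr_apply,
    ← map_add, Prod.mk_add_mk, add_zero, zero_add]

/-- **One piece.** Let `Q ⊆ E₁ × ℝ^I` be polyhedral with `Q ⊆ D × [-R, R]^I` (`D` bounded polyhedral),
`L` Lipschitz on `E₁ × ℝ^I` and `|L| ≤ M` on `Q`. Then `h(ξ) = ∫ 𝟙_Q L (ξ, U) dU` vanishes outside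
a bounded polyhedral set `P ⊆ D` and is Lipschitz on `P`; and every fibre integrand is integrable.
`P` is cut out by `D` and the constraints of `Q` that do not involve `U`; on `P`,
`|h(ξ) − h(ξ')| ≤ (K vol(B) + M ∑ C_c ‖φ_c‖) |ξ − ξ'|` by the slab estimate. [folklore] -/
theorem exists_piece_integral {Q : Set (E₁ × (I → ℝ))} (hQ : IsPolyhedral Q)
    {D : Set E₁} (hD : IsPolyhedral D) (hDb : Bornology.IsBounded D) {R : ℝ}
    (hQB : ∀ p ∈ Q, p.1 ∈ D ∧ ∀ i, |p.2 i| ≤ R)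
    {L : E₁ × (I → ℝ) → ℝ} {K : NNReal} (hL : LipschitzWith K L) {M : ℝ} (hM0 : 0 ≤ M)
    (hM : ∀ p ∈ Q, |L p| ≤ M) :
    ∃ P : Set E₁, IsPolyhedral P ∧ Bornology.IsBounded P ∧
      (∀ ξ, ξ ∉ P → ∫ U, Q.indicator L (ξ, U) = 0) ∧
      (∃ K', LipschitzOnWith K' (fun ξ => ∫ U, Q.indicator L (ξ, U)) P) ∧
      ∀ ξ, Integrable (fun U => Q.indicator L (ξ, U)) := by
  classical
  obtain ⟨ι, hι, φ, b, s, rfl⟩ := hQ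
  -- split each constraint into its `ξ`-part and its `U`-part
  set φ₁ : ι → E₁ →ₗ[ℝ] ℝ := fun i => (φ i).comp (LinearMap.inl ℝ E₁ (I → ℝ)) with hφ₁
  set ψ : ι → (I → ℝ) →ₗ[ℝ] ℝ := fun i => (φ i).comp (LinearMap.inr ℝ E₁ (I → ℝ)) with hψ
  have hdec : ∀ i ξ U, φ i (ξ, U) = φ₁ i ξ + ψ i U := fun i ξ U => linearMap_prod_apply (φ i) ξ U
  set Q : Set (E₁ × (I → ℝ)) := {x | ∀ i, HalfRel (s i) (φ i x) (b i)} with hQdef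
  set Box : Set (I → ℝ) := {U | ∀ i, |U i| ≤ R} with hBox
  -- the fibres
  have hfib : ∀ ξ, Prod.mk ξ ⁻¹' Q = {U | ∀ i, HalfRel (s i) (ψ i U) (b i - φ₁ i ξ)} := by
    intro ξ
    ext U
    simp only [Set.mem_preimage, hQdef, Set.mem_setOf_eq, hdec, halfRel_add_iff]
  have hfib_poly : ∀ ξ, IsPolyhedral (Prod.mk ξ ⁻¹' Q) := fun ξ => by
    rw [hfib ξ]
    exact ⟨ι, hι, ψ, fun i => b i - φ₁ i ξ, s, rfl⟩
  have hfib_sub : ∀ ξ, Prod.mk ξ ⁻¹' Q ⊆ Box := fun ξ U hU => (hQB _ hU).2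
  have hind : ∀ ξ U, Q.indicator L (ξ, U) = (Prod.mk ξ ⁻¹' Q).indicator (fun U => L (ξ, U)) U := by
    intro ξ U
    by_cases h : (ξ, U) ∈ Q
    · rw [Set.indicator_of_mem h, Set.indicator_of_mem (show U ∈ Prod.mk ξ ⁻¹' Q from h)]
    · rw [Set.indicator_of_notMem h, Set.indicator_of_notMem (show U ∉ Prod.mk ξ ⁻¹' Q from h)]
  -- integrability of the fibre integrands
  have hint : ∀ ξ, Integrable (fun U => Q.indicator L (ξ, U)) := by
    intro ξ
    have hcont : Continuous fun U : I → ℝ => L (ξ, U) :=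
      hL.continuous.comp (Continuous.prodMk_right ξ)
    have h1 : IntegrableOn (fun U => L (ξ, U)) (Prod.mk ξ ⁻¹' Q) volume :=
      (hcont.continuousOn.integrableOn_compact (isCompact_absBox R)).mono_set (hfib_sub ξ)
    have h2 := (integrable_indicator_iff (hfib_poly ξ).measurableSet).2 h1
    refine h2.congr (Filter.Eventually.of_forall fun U => ?_)
    exact (hind ξ U).symm
  -- the polytope `P`
  set P : Set E₁ := {ξ | ∀ i : {i // ψ i = 0}, HalfRel (s i) (φ₁ i ξ) (b i)} ∩ D with hP
  have hPpoly : IsPolyhedral P :=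
    (IsPolyhedral.setOf_forall fun i : {i // ψ i = 0} =>
      isPolyhedral_halfRel (s i) (φ₁ i) (b i)).inter hD
  -- vanishing outside `P`
  have hzero : ∀ ξ, ξ ∉ P → ∀ U, (ξ, U) ∉ Q := by
    intro ξ hξ U hU
    apply hξ
    refine ⟨fun i => ?_, (hQB _ hU).1⟩
    have := hU i.1
    rw [hdec, i.2, LinearMap.zero_apply, add_zero] at this
    exact this
  -- slab constants and norms of the `ξ`-parts
  have hslab : ∀ i : {i // ψ i ≠ 0}, ∃ C : ℝ, 0 ≤ C ∧ ∀ lo hi : ℝ, lo ≤ hi →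
      (volume {U : I → ℝ | (∀ j, |U j| ≤ R) ∧ lo ≤ ψ i U ∧ ψ i U ≤ hi}).toReal ≤ C * (hi - lo) :=
    fun i => exists_volume_slab_le (ψ i) i.2 R
  choose C hC0 hC using hslab
  set N : ι → ℝ := fun i => ‖LinearMap.toContinuousLinearMap (φ₁ i)‖ with hN
  have hNle : ∀ i ξ ξ', |φ₁ i ξ - φ₁ i ξ'| ≤ N i * dist ξ ξ' := by
    intro i ξ ξ'
    rw [← map_sub, dist_eq_norm, ← Real.norm_eq_abs]
    have := (LinearMap.toContinuousLinearMap (φ₁ i)).le_opNorm (ξ - ξ')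
    rwa [LinearMap.coe_toContinuousLinearMap'] at this
  set V : ℝ := (volume Box).toReal with hV
  refine ⟨P, hPpoly, hDb.subset Set.inter_subset_right, fun ξ hξ => ?_,
    ⟨Real.toNNReal (K * V + M * ∑ i, C i * N i), ?_⟩, hint⟩
  · -- vanishing
    have : (fun U => Q.indicator L (ξ, U)) = fun _ => 0 := by
      funext U
      exact Set.indicator_of_notMem (hzero ξ hξ U) _
    rw [this, integral_zero]
  · -- Lipschitz estimate on `P`
    refine LipschitzOnWith.of_dist_le' (K := K * V + M * ∑ i, C i * N i) fun ξ hξ ξ' hξ' => ?_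
    set d := dist ξ ξ' with hd
    set lo : {i // ψ i ≠ 0} → ℝ := fun i => min (b i - φ₁ i ξ) (b i - φ₁ i ξ') with hlo
    set hi : {i // ψ i ≠ 0} → ℝ := fun i => max (b i - φ₁ i ξ) (b i - φ₁ i ξ') with hhi
    set Slab : {i // ψ i ≠ 0} → Set (I → ℝ) :=
      fun i => {U | (∀ j, |U j| ≤ R) ∧ lo i ≤ ψ i U ∧ ψ i U ≤ hi i} with hSlab
    have hSlab_meas : ∀ i, MeasurableSet (Slab i) := by
      intro i
      have h1 : IsPolyhedral {U : I → ℝ | lo i ≤ ψ i U} := isPolyhedral_ge _ _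
      have h2 : IsPolyhedral {U : I → ℝ | ψ i U ≤ hi i} := isPolyhedral_le _ _
      have := ((isPolyhedral_absBox (I := I) R).inter (h1.inter h2)).measurableSet
      convert this using 1
      ext U
      simp [hSlab]
    have hSlab_vol : ∀ i, (volume (Slab i)).toReal ≤ C i * (N i * d) := by
      intro i
      refine (hC i (lo i) (hi i) min_le_max).trans ?_
      refine mul_le_mul_of_nonneg_left ?_ (hC0 i)
      rw [hhi, hlo, max_sub_min_eq_abs']
      have : b ↑i - φ₁ i ξ - (b ↑i - φ₁ i ξ') = -(φ₁ i ξ - φ₁ i ξ') := by ring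
      rw [this, abs_neg]
      exact hNle i ξ ξ'
    -- the dominating function
    set bound : (I → ℝ) → ℝ := fun U =>
      K * d * Box.indicator (fun _ => (1 : ℝ)) U +
        M * ∑ i, (Slab i).indicator (fun _ => (1 : ℝ)) U with hbound
    have hi1 : Integrable (fun U => K * d * Box.indicator (fun _ => (1 : ℝ)) U) :=
      Integrable.const_mul ((integrable_indicator_iff (measurableSet_absBox R)).2
        (integrableOn_const (volume_absBox_ne_top R))) _
    have hi2' : ∀ i, Integrable (fun U => (Slab i).indicator (fun _ => (1 : ℝ)) U) := fun i =>
      (integrable_indicator_iff (hSlab_meas i)).2 (integrableOn_const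
        ((measure_mono (fun U hU => hU.1)).trans_lt (isCompact_absBox R).measure_lt_top |>.ne))
    have hi2 : Integrable (fun U => M * ∑ i, (Slab i).indicator (fun _ => (1 : ℝ)) U) :=
      Integrable.const_mul (integrable_finsetSum _ fun i _ => hi2' i) _
    have hbound_int : Integrable bound := hi1.add hi2
    have hsum_nonneg : ∀ U, 0 ≤ ∑ i, (Slab i).indicator (fun _ => (1 : ℝ)) U := fun U =>
      Finset.sum_nonneg fun i _ => Set.indicator_nonneg (fun _ _ => zero_le_one) U
    -- pointwise domination
    have hdom : ∀ U, ‖Q.indicator L (ξ, U) - Q.indicator L (ξ', U)‖ ≤ bound U := by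
      intro U
      rw [Real.norm_eq_abs]
      by_cases h1 : (ξ, U) ∈ Q <;> by_cases h2 : (ξ', U) ∈ Q
      · -- both fibres contain `U`
        rw [Set.indicator_of_mem h1, Set.indicator_of_mem h2]
        have hK := hL.dist_le_mul (ξ, U) (ξ', U)
        rw [Real.dist_eq, Prod.dist_eq, dist_self, max_eq_left dist_nonneg] at hK
        have : 0 ≤ M * ∑ i, (Slab i).indicator (fun _ => (1 : ℝ)) U :=
          mul_nonneg hM0 (hsum_nonneg U)
        have hBU : Box.indicator (fun _ => (1 : ℝ)) U = 1 :=
          Set.indicator_of_mem (show U ∈ Box from (hQB _ h1).2) _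
        simp only [hbound, hBU, mul_one]
        linarith
      · -- `U ∈ Q_ξ ∖ Q_ξ'`: a `U`-constraint is crossed
        rw [Set.indicator_of_mem h1, Set.indicator_of_notMem h2, sub_zero]
        obtain ⟨i, hi2⟩ : ∃ i, ¬ HalfRel (s i) (φ i (ξ', U)) (b i) := by
          simpa [hQdef] using h2
        have hi1 : HalfRel (s i) (φ i (ξ, U)) (b i) := h1 i
        have hψi : ψ i ≠ 0 := by
          intro h0
          apply hi2
          have := hξ'.1 ⟨i, h0⟩
          rw [hdec, h0, LinearMap.zero_apply, add_zero]
          exact this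
        have hUS : U ∈ Slab ⟨i, hψi⟩ := by
          refine ⟨(hQB _ h1).2, ?_, ?_⟩
          · have := (HalfRel.ge_of_not hi2)
            rw [hdec] at this
            exact (min_le_right _ _).trans (by linarith)
          · have := hi1.le
            rw [hdec] at this
            exact le_trans (by linarith) (le_max_left _ _)
        have hle1 : (1 : ℝ) ≤ ∑ j, (Slab j).indicator (fun _ => (1 : ℝ)) U := by
          have := Finset.single_le_sum (f := fun j => (Slab j).indicator (fun _ => (1 : ℝ)) U)
            (fun j _ => Set.indicator_nonneg (fun _ _ => zero_le_one) U) (Finset.mem_univ ⟨i, hψi⟩)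
          rwa [Set.indicator_of_mem hUS] at this
        have hb1 : 0 ≤ K * d * Box.indicator (fun _ => (1 : ℝ)) U :=
          mul_nonneg (mul_nonneg K.2 dist_nonneg) (Set.indicator_nonneg (fun _ _ => zero_le_one) U)
        calc |L (ξ, U)| ≤ M := hM _ h1
          _ ≤ M * ∑ j, (Slab j).indicator (fun _ => (1 : ℝ)) U :=
              le_mul_of_one_le_right hM0 hle1
          _ ≤ bound U := by simp only [hbound]; linarith
      · -- `U ∈ Q_ξ' ∖ Q_ξ`
        rw [Set.indicator_of_notMem h1, Set.indicator_of_mem h2, zero_sub, abs_neg]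
        obtain ⟨i, hi1⟩ : ∃ i, ¬ HalfRel (s i) (φ i (ξ, U)) (b i) := by
          simpa [hQdef] using h1
        have hi2 : HalfRel (s i) (φ i (ξ', U)) (b i) := h2 i
        have hψi : ψ i ≠ 0 := by
          intro h0
          apply hi1
          have := hξ.1 ⟨i, h0⟩
          rw [hdec, h0, LinearMap.zero_apply, add_zero]
          exact this
        have hUS : U ∈ Slab ⟨i, hψi⟩ := by
          refine ⟨(hQB _ h2).2, ?_, ?_⟩
          · have := (HalfRel.ge_of_not hi1)
            rw [hdec] at this
            exact (min_le_left _ _).trans (by linarith)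
          · have := hi2.le
            rw [hdec] at this
            exact le_trans (by linarith) (le_max_right _ _)
        have hle1 : (1 : ℝ) ≤ ∑ j, (Slab j).indicator (fun _ => (1 : ℝ)) U := by
          have := Finset.single_le_sum (f := fun j => (Slab j).indicator (fun _ => (1 : ℝ)) U)
            (fun j _ => Set.indicator_nonneg (fun _ _ => zero_le_one) U) (Finset.mem_univ ⟨i, hψi⟩)
          rwa [Set.indicator_of_mem hUS] at this
        have hb1 : 0 ≤ K * d * Box.indicator (fun _ => (1 : ℝ)) U :=
          mul_nonneg (mul_nonneg K.2 dist_nonneg) (Set.indicator_nonneg (fun _ _ => zero_le_one) U)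
        calc |L (ξ', U)| ≤ M := hM _ h2
          _ ≤ M * ∑ j, (Slab j).indicator (fun _ => (1 : ℝ)) U :=
              le_mul_of_one_le_right hM0 hle1
          _ ≤ bound U := by simp only [hbound]; linarith
      · -- neither
        rw [Set.indicator_of_notMem h1, Set.indicator_of_notMem h2, sub_zero, abs_zero]
        have hb1 : 0 ≤ K * d * Box.indicator (fun _ => (1 : ℝ)) U :=
          mul_nonneg (mul_nonneg K.2 dist_nonneg) (Set.indicator_nonneg (fun _ _ => zero_le_one) U)
        have := mul_nonneg hM0 (hsum_nonneg U)
        simp only [hbound]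
        linarith
    -- integrate the domination
    have hI := hint ξ
    have hI' := hint ξ'
    have hint_bound : ∫ U, bound U = K * d * V + M * ∑ i, (volume (Slab i)).toReal := by
      simp only [hbound]
      rw [integral_add hi1 hi2, integral_const_mul, integral_const_mul,
        integral_indicator_const _ (measurableSet_absBox R), integral_finsetSum _ fun i _ => hi2' i]
      congr 1
      · rw [hV, measureReal_def, smul_eq_mul, mul_one]
      · congr 1
        refine Finset.sum_congr rfl fun i _ => ?_
        rw [integral_indicator_const _ (hSlab_meas i), measureReal_def, smul_eq_mul, mul_one]
    show dist (∫ U, Q.indicator L (ξ, U)) (∫ U, Q.indicator L (ξ', U)) ≤ _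
    rw [Real.dist_eq, ← integral_sub hI hI']
    calc |∫ U, (Q.indicator L (ξ, U) - Q.indicator L (ξ', U))|
        ≤ ∫ U, bound U := by
          have := norm_integral_le_of_norm_le hbound_int (Filter.Eventually.of_forall hdom)
          rwa [Real.norm_eq_abs] at this
      _ = K * d * V + M * ∑ i, (volume (Slab i)).toReal := hint_bound
      _ ≤ K * d * V + M * ∑ i, C i * (N i * d) :=
          add_le_add le_rfl
            (mul_le_mul_of_nonneg_left (Finset.sum_le_sum fun i _ => hSlab_vol i) hM0)
      _ = (K * V + M * ∑ i, C i * N i) * d := by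
          have : ∑ i, C i * (N i * d) = (∑ i, C i * N i) * d := by
            rw [Finset.sum_mul]
            exact Finset.sum_congr rfl fun i _ => by ring
          rw [this]
          ring

end Piece

/-! ### Fibre integrals of `PolyLip` functions -/

section Fibre

variable {E₁ : Type*} [NormedAddCommGroup E₁] [NormedSpace ℝ E₁] [FiniteDimensional ℝ E₁]
variable {I : Type*} [Fintype I]

/-- **Fibre integration.** Let `F ∈ PolyLip(E₁ × ℝ^I)` vanish outside `D × [-R, R]^I` with `D`
bounded polyhedral. Then `ξ ↦ ∫ F(ξ, U) dU` is piecewise Lipschitz on bounded polyhedral pieces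
(`IsPiecewiseLipschitz'`): cut every piece of `F` down to `D × [-R, R]^I` and apply
`exists_piece_integral` piece by piece. This is the regularity statement used implicitly for the
functions defined by (fsl) in the proofs of Theorems 6.3 and 9.1.
[cite: FordMaynard2024PrimeSieves, §6.2 (proof of Theorem 6.3) and §9 (proof of Theorem 9.1)] -/
theorem PolyLip.isPiecewiseLipschitz'_integral {F : E₁ × (I → ℝ) → ℝ} (hF : PolyLip F)
    {D : Set E₁} (hD : IsPolyhedral D) (hDb : Bornology.IsBounded D) {R : ℝ}
    (h0 : ∀ ξ U, F (ξ, U) ≠ 0 → ξ ∈ D ∧ ∀ i, |U i| ≤ R) :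
    IsPiecewiseLipschitz' (fun ξ => ∫ U, F (ξ, U)) := by
  classical
  obtain ⟨ι, hι, Q, L, hQ, hFsum⟩ := hF
  set B : Set (E₁ × (I → ℝ)) := {p | p.1 ∈ D ∧ ∀ i, |p.2 i| ≤ R} with hB
  have hBpoly : IsPolyhedral B := by
    have h1 : IsPolyhedral ((LinearMap.fst ℝ E₁ (I → ℝ)) ⁻¹' D) := hD.preimage _
    have h2 : IsPolyhedral ((LinearMap.snd ℝ E₁ (I → ℝ)) ⁻¹' {U : I → ℝ | ∀ i, |U i| ≤ R}) :=
      (isPolyhedral_absBox R).preimage _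
    convert h1.inter h2 using 1
    rw [hB]
    ext p
    simp
  -- cut the pieces down to `B` and make the Lipschitz parts global
  have hpiece : ∀ t, ∃ (L' : E₁ × (I → ℝ) → ℝ) (K : NNReal) (M : ℝ), LipschitzWith K L' ∧ 0 ≤ M ∧
      (∀ p ∈ Q t ∩ B, |L' p| ≤ M) ∧ ∀ p, (Q t ∩ B).indicator (L t) p = (Q t ∩ B).indicator L' p := by
    intro t
    obtain ⟨K, hK⟩ := (hQ t).2.1
    obtain ⟨M, hM⟩ := (hQ t).2.2
    obtain ⟨L', hL', hEq⟩ := (hK.mono Set.inter_subset_left).extend_real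
    refine ⟨L', K, max M 0, hL', le_max_right _ _, fun p hp => ?_, fun p => ?_⟩
    · rw [← hEq hp]
      exact (hM p hp.1).trans (le_max_left _ _)
    · exact congrFun (Set.indicator_congr hEq) p
  choose L' K M hL' hM0 hM hLL' using hpiece
  have hP : ∀ t, ∃ P : Set E₁, IsPolyhedral P ∧ Bornology.IsBounded P ∧
      (∀ ξ, ξ ∉ P → ∫ U, (Q t ∩ B).indicator (L' t) (ξ, U) = 0) ∧
      (∃ K', LipschitzOnWith K' (fun ξ => ∫ U, (Q t ∩ B).indicator (L' t) (ξ, U)) P) ∧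
      ∀ ξ, Integrable (fun U => (Q t ∩ B).indicator (L' t) (ξ, U)) := fun t =>
    exists_piece_integral ((hQ t).1.inter hBpoly) hD hDb (fun p hp => hp.2) (hL' t) (hM0 t) (hM t)
  choose P hPpoly hPbdd hPzero hPlip hPint using hP
  -- `F` is the sum of the cut pieces
  have hFB : ∀ p, F p = ∑ t, (Q t ∩ B).indicator (L' t) p := by
    intro p
    by_cases hp : p ∈ B
    · rw [hFsum p]
      refine Finset.sum_congr rfl fun t _ => ?_
      rw [← hLL' t p]
      by_cases hq : p ∈ Q t
      · rw [Set.indicator_of_mem hq, Set.indicator_of_mem (Set.mem_inter hq hp)]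
      · rw [Set.indicator_of_notMem hq, Set.indicator_of_notMem fun h => hq h.1]
    · have hF0 : F p = 0 := by
        by_contra h
        exact hp (h0 p.1 p.2 h)
      rw [hF0]
      symm
      refine Finset.sum_eq_zero fun t _ => Set.indicator_of_notMem (fun h => hp h.2) _
  refine ⟨ι, hι, P, fun t ξ => ∫ U, (Q t ∩ B).indicator (L' t) (ξ, U),
    fun t => ⟨hPpoly t, hPbdd t, hPzero t, hPlip t⟩, fun ξ => ?_⟩
  show ∫ U, F (ξ, U) = ∑ t, ∫ U, (Q t ∩ B).indicator (L' t) (ξ, U)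
  rw [← integral_finsetSum _ fun t _ => hPint t ξ]
  exact integral_congr_ae (Filter.Eventually.of_forall fun U => hFB (ξ, U))

end Fibre

end Literature.NumberTheory.Sieve.FordMaynard
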